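import Literature.Analysis.FluidPDE.Tao2016AveragedNS.RetunedTransition
import HarnessLib

/-!
# What no tuning can beat, part 1 of 3: the conservation-law limits of ONE gate
# (the general five-coupling circuit; trigger budget; output ≤ rotor × ∫trigger; the arming law)

Cell `pub-fluidc`, blueprint seat bp1 (gen 21); ONE text split by the 400-line rule into
`GateBudget.lean` (this file) + `GateBudgetArming.lean` + `GateBudgetZeno.lean`; namespace
`Summit.NavierStokesRegularity.FluidComputer.GateBudget`. HONEST FRAMING (verbatim): low prior, high
value-of-information experiment on Tao's machine paradigm; NOT a claim that NS blows up. Everything concerns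
five-mode quadratic ODEs on `ℝ⁵` — Tao's truncation (5.5) of [Tao2016AveragedNS, §5.5] and the family below —
started EXACTLY at (5.6) `delayInit = (1,0,0,0,0)`; nothing is proved about the Navier–Stokes equations.

## The question (paper/sec-tao-machine.md §2.4m, Reading (ii)/(iv): the NECESSITY columns of the scorecard)

Every positive statement the cell has typed about Tao's delay gate is a SUFFICIENCY statement (Theorem 5.3
under some threshold: `Thm53With.transitionWith_explicit`, and bp1 gen 20's `AmplitudeKnob.transition_polyThreshold`,
`HeadStart.firingPhase_poly`, …), each a ~2000-line bootstrap valid in ONE corner of parameter space, and in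
all of them the ROTOR coupling is frozen at Tao's `ε⁻²`. This text asks the opposite question — which
inequalities among the five couplings must EVERY working gate satisfy? — and answers it with four laws that
hold for EVERY exact trajectory from (5.6) and ALL values of the couplings, proved from the three local
energy identities of the circuit and one-line derivative comparisons only (no bootstrap, no hitting times).
To make the rotor a knob the circuit is re-parametrised by its five couplings:

  `fiveGateCircuit ε σ μ R K`:  `∂ₜa = -Rcd - εab - σac`, `∂ₜb = εa² - μc²`, `∂ₜc = σa² + μbc`,
  `∂ₜd = Rca - Kdã`, `∂ₜã = Kd²`

— pump `ε : a → b` (the CLOCK), pump `σ : a → c` (the SEED), amplifier `μ : b ⇒ c` (the TRIGGER), rotor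
`R : c ∘ (a,d)`, pump `K : d → ã` (the DRAIN). Tao's retuned family is the three-parameter slice
`delayCircuitWith K M ε = fiveGateCircuit ε (ε²e^{-M}) (ε⁻¹M) ε⁻² K` (`delayCircuitWith_eq_fiveGate`, by `rfl`)
and (5.5) itself is `M = K¹⁰` (`delayCircuit_eq_fiveGate`).

## What is proved here (all `t ≥ 0`, exact trajectories from `delayInit`)

* §1 the circuit is the superposition of its five gates, cancels, conserves energy (`|Xᵢ| ≤ 1`); `c ≥ 0`,
  `ã` non-decreasing; the local identities `∂ₜ(b²+c²) = 2εa²b + 2σa²c` (the amplifier cancels) and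
  `∂ₜ(d²+ã²) = 2Rcad` (the drain cancels).
* §2 a comparison lemma `sqrt_le_of_deriv_le`: `W ≥ 0`, `∂ₜW ≤ 2g√W` ⇒ `√W(t) ≤ √W(0) + ∫₀ᵗ g`.
* §3 TRIGGER BUDGET (`trigger_budget`): `√(b²+c²)(t) ≤ (ε+σ)t` — the trigger pair never holds more than the
  two weak pumps deliver (for Tao's family `(1 + εe^{-M})εt`, sharper than (ob-2)'s `5ε`).
* §4 OUTPUT ≤ ROTOR × ∫TRIGGER (`output_le_rotor_trigger`): `√(d²+ã²)(t) ≤ R(ε+σ)t²/2`. The first rotor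
  NECESSITY: an output `ã(T) ≥ θ` needs `R ≥ 2θ/((ε+σ)T²)` (`rotor_necessary_weak`).
* Part 2 (`GateBudgetArming.lean`), THE ARMING LAW: `c(t) ≤ σt·e^{κt²/2}` and
  `√(d²+ã²)(t) ≤ (Rσ/κ)(e^{κt²/2} - 1)`, `κ = μ(ε+σ)`: no output until the swept amplifier has supplied
  `log(κ/(Rσ))` e-folds; for Tao's family `ã(t) ≤ (e/M)·e^{-M(1 - t²/2)}` on `[0, √2]` for EVERY drain `K` and
  amplitude `0 < ε ≤ 1` — the delay `√2` of Theorem 5.3 cannot be shortened by tuning.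
* Part 3 (`GateBudgetZeno.lean`), the CLOCK BUDGET `μ∫₀ᵀc² ≤ (2ε+σ)T` and the ZENO LAW
  `ã(T) ≥ θ ⇒ Kθ³μ ≤ 4R²(2ε+σ)T`, whence the rotor / drain / amplifier / amplitude necessity inequalities
  (Tao's family: `ε²·M·K·θ³ ≤ 12T`).
[cite: Tao2016AveragedNS, §5.5 (5.5), (5.6), Theorem 5.3 and its proof: (energy-con), (ob-2), (est)].
No named facts; 0 sorry.
-/

noncomputable section

namespace Summit.NavierStokesRegularity.FluidComputer.GateBudget

open Real Set Filter Topology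
open Literature.Analysis.FluidPDE.Tao2016AveragedNS
open Literature.Analysis.FluidPDE.Tao2016AveragedNS.Thm53 (antitoneOn_intFactor monotoneOn_intFactor
  antitoneOn_sub_of_deriv_le monotoneOn_sub_of_le_deriv init_a init_b init_c init_d init_e)

/-! ## §1 The general five-coupling circuit and its conservation laws -/

/-- **The five-gate circuit with free couplings** `(ε, σ, μ, R, K)` on modes `(a,b,c,d,ã) = (X 0,…,X 4)`:
`∂ₜa = -Rcd - εab - σac`, `∂ₜb = εa² - μc²`, `∂ₜc = σa² + μbc`, `∂ₜd = Rca - Kdã`, `∂ₜã = Kd²`.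
[cite: Tao2016AveragedNS, §5.5 (5.5)] -/
def fiveGateCircuit (ε σ μ R K : ℝ) (X : Fin 5 → ℝ) : Fin 5 → ℝ :=
  ![-(R * X 2 * X 3) - ε * X 0 * X 1 - σ * X 0 * X 2,
    ε * X 0 ^ 2 - μ * X 2 ^ 2,
    σ * X 0 ^ 2 + μ * X 1 * X 2,
    R * X 2 * X 0 - K * X 3 * X 4,
    K * X 3 ^ 2]

/-- Tao's retuned family is the slice `σ = ε²e^{-M}`, `μ = ε⁻¹M`, `R = ε⁻²` (definitionally).
[cite: Tao2016AveragedNS, §5.5 (5.5)] -/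
theorem delayCircuitWith_eq_fiveGate (K M ε : ℝ) :
    delayCircuitWith K M ε = fiveGateCircuit ε (ε ^ 2 * exp (-M)) (ε⁻¹ * M) ((ε ^ 2)⁻¹) K := rfl

/-- Tao's circuit (5.5) is the member `σ = ε²e^{-K¹⁰}`, `μ = ε⁻¹K¹⁰`, `R = ε⁻²`.
[cite: Tao2016AveragedNS, §5.5 (5.5)] -/
theorem delayCircuit_eq_fiveGate (K ε : ℝ) :
    delayCircuit K ε = fiveGateCircuit ε (ε ^ 2 * exp (-K ^ 10)) (ε⁻¹ * K ^ 10) ((ε ^ 2)⁻¹) K := rfl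

/-- The circuit is the superposition of its five gates. [cite: Tao2016AveragedNS, §5.5 p. 28] -/
theorem fiveGateCircuit_eq_gates (ε σ μ R K : ℝ) :
    fiveGateCircuit ε σ μ R K =
      pumpOn ε 0 1 + pumpOn σ 0 2 + amplifierOn μ 1 2 + rotorOn R 0 3 2 + pumpOn K 3 4 := by
  funext X; ext l
  fin_cases l <;> simp [fiveGateCircuit, pumpOn, amplifierOn, rotorOn] <;> ring

/-- Every member cancels ((g-cancel)). [cite: Tao2016AveragedNS, §5.5] -/
theorem isCancelling_fiveGateCircuit (ε σ μ R K : ℝ) : IsCancelling (fiveGateCircuit ε σ μ R K) := by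
  rw [fiveGateCircuit_eq_gates]
  exact ((((isCancelling_pumpOn _ _ _).add (isCancelling_pumpOn _ _ _)).add
    (isCancelling_amplifierOn _ _ _)).add (isCancelling_rotorOn _ _ _ _)).add (isCancelling_pumpOn _ _ _)

variable {ε σ μ R K : ℝ} {X : ℝ → Fin 5 → ℝ}

/-- (energy-con): from (5.6) the energy is `1` for all times. [cite: Tao2016AveragedNS, §5.5 (energy-con)] -/
theorem energy_init (hX : ∀ t, HasDerivAt X (fiveGateCircuit ε σ μ R K (X t)) t)
    (h0 : X 0 = delayInit) (t : ℝ) : energy (X t) = 1 := by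
  rw [energy_eq_of_isCancelling (isCancelling_fiveGateCircuit ε σ μ R K) hX t 0, h0]
  simp [energy, delayInit, Fin.sum_univ_five]

/-- (est): every mode is `O(1)`: `Xᵢ² ≤ 1`. [cite: Tao2016AveragedNS, §5.5 (est)] -/
theorem traj_sq_le_one (hX : ∀ t, HasDerivAt X (fiveGateCircuit ε σ μ R K (X t)) t)
    (h0 : X 0 = delayInit) (t : ℝ) (i : Fin 5) : X t i ^ 2 ≤ 1 := by
  have h := energy_init hX h0 t
  rw [energy] at h
  calc X t i ^ 2 ≤ ∑ j, X t j ^ 2 :=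
        Finset.single_le_sum (f := fun j => X t j ^ 2) (fun j _ => sq_nonneg (X t j)) (Finset.mem_univ i)
    _ = 1 := h

/-- (est): `|Xᵢ| ≤ 1`. [cite: Tao2016AveragedNS, §5.5 (est)] -/
theorem traj_abs_le_one (hX : ∀ t, HasDerivAt X (fiveGateCircuit ε σ μ R K (X t)) t)
    (h0 : X 0 = delayInit) (t : ℝ) (i : Fin 5) : |X t i| ≤ 1 :=
  sq_le_one_iff_abs_le_one _ |>.1 (traj_sq_le_one hX h0 t i)

/-- Each mode of a trajectory is continuous. [folklore] -/
theorem continuous_traj (hX : ∀ t, HasDerivAt X (fiveGateCircuit ε σ μ R K (X t)) t) (i : Fin 5) :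
    Continuous fun s => X s i :=
  (continuous_apply i).comp (continuous_iff_continuousAt.2 fun t => (hX t).continuousAt)

/-- (b-eq): `∂ₜb = εa² - μc²`. [cite: Tao2016AveragedNS, §5.5 (5.5)] -/
theorem hasDerivAt_b (hX : ∀ t, HasDerivAt X (fiveGateCircuit ε σ μ R K (X t)) t) (t : ℝ) :
    HasDerivAt (fun s => X s 1) (ε * X t 0 ^ 2 - μ * X t 2 ^ 2) t :=
  (hasDerivAt_pi.1 (hX t) 1).congr_deriv (by simp [fiveGateCircuit])

/-- (c-eq): `∂ₜc = σa² + μbc`. [cite: Tao2016AveragedNS, §5.5 (5.5)] -/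
theorem hasDerivAt_c (hX : ∀ t, HasDerivAt X (fiveGateCircuit ε σ μ R K (X t)) t) (t : ℝ) :
    HasDerivAt (fun s => X s 2) (σ * X t 0 ^ 2 + μ * X t 1 * X t 2) t :=
  (hasDerivAt_pi.1 (hX t) 2).congr_deriv (by simp [fiveGateCircuit])

/-- (ta-eq): `∂ₜã = Kd²`. [cite: Tao2016AveragedNS, §5.5 (5.5)] -/
theorem hasDerivAt_e (hX : ∀ t, HasDerivAt X (fiveGateCircuit ε σ μ R K (X t)) t) (t : ℝ) :
    HasDerivAt (fun s => X s 4) (K * X t 3 ^ 2) t :=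
  (hasDerivAt_pi.1 (hX t) 4).congr_deriv (by simp [fiveGateCircuit])

/-- `∂ₜ(b² + c²) = 2εa²b + 2σa²c` — the amplifier cancels inside the trigger pair; only the two weak pumps
feed it. [cite: Tao2016AveragedNS, §5.5 proof (ob-2)] -/
theorem bc_energy {t : ℝ} (hX : HasDerivAt X (fiveGateCircuit ε σ μ R K (X t)) t) :
    HasDerivAt (fun s => X s 1 ^ 2 + X s 2 ^ 2)
      (2 * ε * X t 0 ^ 2 * X t 1 + 2 * σ * X t 0 ^ 2 * X t 2) t := by
  refine (((hasDerivAt_pi.1 hX 1).fun_pow 2).fun_add ((hasDerivAt_pi.1 hX 2).fun_pow 2)).congr_deriv ?_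
  simp only [show (2 : ℕ) - 1 = 1 from rfl, pow_one, Nat.cast_ofNat, fiveGateCircuit, Fin.isValue,
    Matrix.cons_val_one, Matrix.cons_val_two, Matrix.cons_val_zero, Matrix.head_cons, Matrix.tail_cons]
  ring

/-- `∂ₜ(d² + ã²) = 2Rcad` — the drain cancels inside the output pair; only the rotor feeds it.
[cite: Tao2016AveragedNS, §5.5 proof (dora)] -/
theorem out_energy {t : ℝ} (hX : HasDerivAt X (fiveGateCircuit ε σ μ R K (X t)) t) :
    HasDerivAt (fun s => X s 3 ^ 2 + X s 4 ^ 2) (2 * R * X t 2 * X t 0 * X t 3) t := by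
  refine (((hasDerivAt_pi.1 hX 3).fun_pow 2).fun_add ((hasDerivAt_pi.1 hX 4).fun_pow 2)).congr_deriv ?_
  simp only [show (2 : ℕ) - 1 = 1 from rfl, pow_one, Nat.cast_ofNat, fiveGateCircuit, Fin.isValue,
    Matrix.cons_val]
  ring

/-- `c(t) ≥ 0` for `t ≥ 0` when the seed pump is non-negative (integrating factor `e^{-∫₀ᵗ μb}`).
[cite: Tao2016AveragedNS, §5.5 proof ("comparison argument")] -/
theorem c_nonneg (hX : ∀ t, HasDerivAt X (fiveGateCircuit ε σ μ R K (X t)) t) (h0 : X 0 = delayInit)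
    (hσ : 0 ≤ σ) {t : ℝ} (ht : 0 ≤ t) : 0 ≤ X t 2 := by
  set G : ℝ → ℝ := fun s => ∫ r in (0 : ℝ)..s, μ * X r 1 with hG
  have hGd : ∀ s, HasDerivAt G (μ * X s 1) s := fun s =>
    ((continuous_const.mul (continuous_traj hX 1)).integral_hasStrictDerivAt 0 s).hasDerivAt
  have hmono := monotoneOn_intFactor (s := univ) (φ := fun _ => 0) (Φ := fun _ => 0) convex_univ
    (fun s _ => hasDerivAt_c hX s) (fun s _ => hGd s) (fun s _ => hasDerivAt_const s (0 : ℝ))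
    (fun s _ => by
      have : (σ * X s 0 ^ 2 + μ * X s 1 * X s 2 - μ * X s 1 * X s 2) * exp (-G s)
          = σ * X s 0 ^ 2 * exp (-G s) := by ring
      rw [this]; positivity)
  have h := hmono (mem_univ 0) (mem_univ t) ht
  simp only [init_c h0, zero_mul, sub_zero] at h
  exact (mul_nonneg_iff_of_pos_right (exp_pos (-G t))).1 h

/-- The output `ã` is non-decreasing (`∂ₜã = Kd² ≥ 0`, `K ≥ 0`); in particular `ã ≥ 0` for `t ≥ 0`.
[cite: Tao2016AveragedNS, §5.5 (ta-eq)] -/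
theorem e_monotone (hX : ∀ t, HasDerivAt X (fiveGateCircuit ε σ μ R K (X t)) t) (hK : 0 ≤ K) :
    Monotone fun t => X t 4 := by
  refine monotone_of_deriv_nonneg (fun t => (hasDerivAt_e hX t).differentiableAt) fun t => ?_
  rw [(hasDerivAt_e hX t).deriv]
  positivity

/-! ## §2 The comparison lemma behind every budget -/

/-- **Square-root comparison.** If `W ≥ 0` on `[0,∞)` with `∂ₜW ≤ 2g√W` (`g ≥ 0`, `∂ₜG = g`) then
`√W(t) ≤ √W(0) + (G(t) - G(0))` for `t ≥ 0`. (Apply the derivative bound to `√(W + η²)`, whose derivative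
is `∂ₜW/(2√(W+η²)) ≤ g`, and let `η → 0`.) [folklore] -/
theorem sqrt_le_of_deriv_le {W w g G : ℝ → ℝ}
    (hW : ∀ t, 0 ≤ t → HasDerivAt W (w t) t) (hG : ∀ t, 0 ≤ t → HasDerivAt G (g t) t)
    (hW0 : ∀ t, 0 ≤ t → 0 ≤ W t) (hg : ∀ t, 0 ≤ t → 0 ≤ g t)
    (h : ∀ t, 0 ≤ t → w t ≤ 2 * g t * sqrt (W t)) {t : ℝ} (ht : 0 ≤ t) :
    sqrt (W t) ≤ sqrt (W 0) + (G t - G 0) := by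
  refine le_of_forall_pos_le_add fun η hη => ?_
  have hVd : ∀ s ∈ Ici (0 : ℝ),
      HasDerivAt (fun r => sqrt (W r + η ^ 2)) (w s / (2 * sqrt (W s + η ^ 2))) s := by
    intro s hs
    have hWs : 0 ≤ W s := hW0 s hs
    exact ((hW s hs).add_const (η ^ 2)).sqrt (by positivity)
  have hanti := antitoneOn_sub_of_deriv_le (f := fun r => sqrt (W r + η ^ 2))
    (f' := fun s => w s / (2 * sqrt (W s + η ^ 2))) (φ := g) (Φ := G) (convex_Ici 0) hVd
    (fun s hs => hG s hs) (fun s hs => by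
      have hWs : 0 ≤ W s := hW0 s hs
      have hVpos : 0 < sqrt (W s + η ^ 2) := sqrt_pos.2 (by positivity)
      rw [div_le_iff₀ (by positivity)]
      have hWV : sqrt (W s) ≤ sqrt (W s + η ^ 2) := sqrt_le_sqrt (by nlinarith)
      have h1 := h s hs
      have h2 := hg s hs
      nlinarith [mul_le_mul_of_nonneg_left hWV (by positivity : (0 : ℝ) ≤ 2 * g s)])
  have hmain := hanti (mem_Ici.2 le_rfl) (mem_Ici.2 ht) ht
  dsimp only at hmain
  have h1 : sqrt (W t) ≤ sqrt (W t + η ^ 2) := sqrt_le_sqrt (by nlinarith)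
  have h2 : sqrt (W 0 + η ^ 2) ≤ sqrt (W 0) + η := by
    rw [sqrt_le_left (by positivity)]
    nlinarith [sqrt_nonneg (W 0), sq_sqrt (hW0 0 le_rfl), mul_nonneg (sqrt_nonneg (W 0)) hη.le]
  linarith

/-- `∂ₜ(c·t²/2) = c·t`. [folklore] -/
theorem hasDerivAt_sq_half (c s : ℝ) : HasDerivAt (fun r : ℝ => c * r ^ 2 / 2) (c * s) s := by
  have h := ((hasDerivAt_id' s).mul (hasDerivAt_id' s)).const_mul (c / 2)
  have hfun : (fun r : ℝ => c * r ^ 2 / 2) = fun x => c / 2 * (x * x) := by funext x; ring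
  rw [hfun]
  exact h.congr_deriv (by ring)

/-! ## §3 The trigger budget -/

/-- **TRIGGER BUDGET.** `√(b² + c²)(t) ≤ (ε + σ)t` for `t ≥ 0` (`ε, σ ≥ 0`; every `μ, R, K`): the trigger pair
never holds more amplitude than the clock and seed pumps deliver, whatever the amplifier does.
[cite: Tao2016AveragedNS, §5.5 proof (ob-2)] -/
theorem trigger_budget (hX : ∀ t, HasDerivAt X (fiveGateCircuit ε σ μ R K (X t)) t)
    (h0 : X 0 = delayInit) (hε : 0 ≤ ε) (hσ : 0 ≤ σ) {t : ℝ} (ht : 0 ≤ t) :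
    sqrt (X t 1 ^ 2 + X t 2 ^ 2) ≤ (ε + σ) * t := by
  have h := sqrt_le_of_deriv_le (W := fun s => X s 1 ^ 2 + X s 2 ^ 2)
    (w := fun s => 2 * ε * X s 0 ^ 2 * X s 1 + 2 * σ * X s 0 ^ 2 * X s 2)
    (g := fun _ => ε + σ) (G := fun s => (ε + σ) * s)
    (fun s _ => bc_energy (hX s)) (fun s _ => ((hasDerivAt_id' s).const_mul (ε + σ)).congr_deriv (by simp))
    (fun s _ => by positivity) (fun s _ => by positivity) (fun s _ => ?_) ht
  · simpa [init_b h0, init_c h0] using h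
  · set V := sqrt (X s 1 ^ 2 + X s 2 ^ 2) with hV
    have hb : |X s 1| ≤ V := abs_le_sqrt (by nlinarith [sq_nonneg (X s 2)])
    have hc : |X s 2| ≤ V := abs_le_sqrt (by nlinarith [sq_nonneg (X s 1)])
    have ha : X s 0 ^ 2 ≤ 1 := traj_sq_le_one hX h0 s 0
    have ha0 : 0 ≤ X s 0 ^ 2 := sq_nonneg _
    have h1 : X s 0 ^ 2 * X s 1 ≤ V := by
      have e1 : X s 0 ^ 2 * X s 1 ≤ X s 0 ^ 2 * |X s 1| := mul_le_mul_of_nonneg_left (le_abs_self _) ha0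
      have e2 : X s 0 ^ 2 * |X s 1| ≤ 1 * V := mul_le_mul ha hb (abs_nonneg _) zero_le_one
      linarith
    have h2 : X s 0 ^ 2 * X s 2 ≤ V := by
      have e1 : X s 0 ^ 2 * X s 2 ≤ X s 0 ^ 2 * |X s 2| := mul_le_mul_of_nonneg_left (le_abs_self _) ha0
      have e2 : X s 0 ^ 2 * |X s 2| ≤ 1 * V := mul_le_mul ha hc (abs_nonneg _) zero_le_one
      linarith
    show 2 * ε * X s 0 ^ 2 * X s 1 + 2 * σ * X s 0 ^ 2 * X s 2 ≤ 2 * (ε + σ) * V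
    nlinarith [mul_le_mul_of_nonneg_left h1 hε, mul_le_mul_of_nonneg_left h2 hσ]

/-- The clock never exceeds its budget: `|b(t)| ≤ (ε+σ)t`. [cite: Tao2016AveragedNS, §5.5 proof (ob-2)] -/
theorem abs_b_le (hX : ∀ t, HasDerivAt X (fiveGateCircuit ε σ μ R K (X t)) t)
    (h0 : X 0 = delayInit) (hε : 0 ≤ ε) (hσ : 0 ≤ σ) {t : ℝ} (ht : 0 ≤ t) :
    |X t 1| ≤ (ε + σ) * t :=
  (abs_le_sqrt (by nlinarith [sq_nonneg (X t 2)])).trans (trigger_budget hX h0 hε hσ ht)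

/-- The trigger never exceeds the budget: `0 ≤ c(t) ≤ (ε+σ)t`. [cite: Tao2016AveragedNS, §5.5 proof (ob-2)] -/
theorem c_le (hX : ∀ t, HasDerivAt X (fiveGateCircuit ε σ μ R K (X t)) t)
    (h0 : X 0 = delayInit) (hε : 0 ≤ ε) (hσ : 0 ≤ σ) {t : ℝ} (ht : 0 ≤ t) :
    X t 2 ≤ (ε + σ) * t :=
  ((le_abs_self _).trans (abs_le_sqrt (by nlinarith [sq_nonneg (X t 1)]))).trans
    (trigger_budget hX h0 hε hσ ht)

/-! ## §4 Output ≤ rotor × time-integral of the trigger -/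

/-- **OUTPUT ≤ ROTOR × ∫TRIGGER.** `√(d² + ã²)(t) ≤ R(ε+σ)t²/2` for `t ≥ 0` (`ε, σ, R ≥ 0`; every `μ, K`): the
output pair is fed only by the rotor, at rate `2Rcad ≤ 2R|c|√(d²+ã²)`, and `|c| ≤ (ε+σ)t`.
[cite: Tao2016AveragedNS, §5.5 proof (dora)] -/
theorem output_le_rotor_trigger (hX : ∀ t, HasDerivAt X (fiveGateCircuit ε σ μ R K (X t)) t)
    (h0 : X 0 = delayInit) (hε : 0 ≤ ε) (hσ : 0 ≤ σ) (hR : 0 ≤ R) {t : ℝ} (ht : 0 ≤ t) :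
    sqrt (X t 3 ^ 2 + X t 4 ^ 2) ≤ R * (ε + σ) * t ^ 2 / 2 := by
  have h := sqrt_le_of_deriv_le (W := fun s => X s 3 ^ 2 + X s 4 ^ 2)
    (w := fun s => 2 * R * X s 2 * X s 0 * X s 3) (g := fun s => R * (ε + σ) * s)
    (G := fun s => R * (ε + σ) * s ^ 2 / 2)
    (fun s _ => out_energy (hX s)) (fun s _ => hasDerivAt_sq_half (R * (ε + σ)) s)
    (fun s _ => by positivity) (fun s hs => by positivity) (fun s hs => ?_) ht
  · simpa [init_d h0, init_e h0] using h
  · set V := sqrt (X s 3 ^ 2 + X s 4 ^ 2) with hV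
    have hd : |X s 3| ≤ V := abs_le_sqrt (by nlinarith [sq_nonneg (X s 4)])
    have hc : |X s 2| ≤ (ε + σ) * s :=
      (abs_le_sqrt (by nlinarith [sq_nonneg (X s 1)])).trans (trigger_budget hX h0 hε hσ hs)
    have ha : |X s 0| ≤ 1 := traj_abs_le_one hX h0 s 0
    have h3 : X s 2 * X s 0 * X s 3 ≤ (ε + σ) * s * V := by
      have habs : |X s 2 * X s 0 * X s 3| = |X s 2| * |X s 0| * |X s 3| := by rw [abs_mul, abs_mul]
      have hle : |X s 2| * |X s 0| * |X s 3| ≤ (ε + σ) * s * 1 * V :=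
        mul_le_mul (mul_le_mul hc ha (abs_nonneg _) (by positivity)) hd (abs_nonneg _) (by positivity)
      calc X s 2 * X s 0 * X s 3 ≤ |X s 2 * X s 0 * X s 3| := le_abs_self _
        _ = |X s 2| * |X s 0| * |X s 3| := habs
        _ ≤ (ε + σ) * s * 1 * V := hle
        _ = (ε + σ) * s * V := by ring
    show 2 * R * X s 2 * X s 0 * X s 3 ≤ 2 * (R * (ε + σ) * s) * V
    nlinarith [mul_le_mul_of_nonneg_left h3 hR]

/-- The output itself: `ã(t) ≤ R(ε+σ)t²/2`. [cite: Tao2016AveragedNS, §5.5 proof (dora)] -/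
theorem e_le_rotor_trigger (hX : ∀ t, HasDerivAt X (fiveGateCircuit ε σ μ R K (X t)) t)
    (h0 : X 0 = delayInit) (hε : 0 ≤ ε) (hσ : 0 ≤ σ) (hR : 0 ≤ R) {t : ℝ} (ht : 0 ≤ t) :
    X t 4 ≤ R * (ε + σ) * t ^ 2 / 2 :=
  ((le_abs_self _).trans (abs_le_sqrt (by nlinarith [sq_nonneg (X t 3)]))).trans
    (output_le_rotor_trigger hX h0 hε hσ hR ht)

/-- **ROTOR NECESSITY, weak form.** If the gate has delivered `ã(T) ≥ θ` by a time `T ≥ 0` then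
`2θ ≤ R(ε+σ)T²`: a rotor weaker than `2θ/((ε+σ)T²)` cannot fire the gate by time `T`, for ANY amplifier and
drain. (Part 2 sharpens this by the factor `√(μK)`.) [cite: Tao2016AveragedNS, §5.5 Thm 5.3] -/
theorem rotor_necessary_weak (hX : ∀ t, HasDerivAt X (fiveGateCircuit ε σ μ R K (X t)) t)
    (h0 : X 0 = delayInit) (hε : 0 ≤ ε) (hσ : 0 ≤ σ) (hR : 0 ≤ R) {T θ : ℝ} (hT : 0 ≤ T)
    (hθ : θ ≤ X T 4) : 2 * θ ≤ R * (ε + σ) * T ^ 2 := by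
  have := e_le_rotor_trigger hX h0 hε hσ hR hT
  linarith

end Summit.NavierStokesRegularity.FluidComputer.GateBudget
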